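import Literature.MathematicalPhysics.QuantumLattice.ReflectedCorrelationPolarisation
import HarnessLib

/-!
# Osterwalder–Schrader polarisation with an additive (thermal) slack

Sequel of `ReflectedCorrelationPolarisation` (abstract measure-theoretic bookkeeping for
transfer-matrix arguments: any finite measure `μ` on `Ω`, measurable maps `Θ, τ : Ω → Ω`). On a
torus of finite time extent the diagonal transfer-matrix bound in OS currency does NOT hold with
the OS variance alone: the backward (thermal) propagation around the torus contributes terms that
are small but controlled only by SUP norms. The honest diagonal hypothesis is therefore
`‖osCorr τ (Z, Z)‖ ≤ osVar Z · E + δ · B_Z²` for every sup bound `B_Z` of `Z` (and, at zero time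
shift, `osVar Z ≥ −δ B_Z²`). This file proves that polarisation carries the slack through:

* `norm_add_smul_le_of_norm_eq_one` — `‖(X + cY)(ω)‖ ≤ B_X + B_Y` for `‖c‖ = 1`;
* `osVar_add_smul_le_of_slack` — the parallelogram bound `osVar(X + cY) ≤ 2 osVar X + 2 osVar Y + δ (B_X + B_Y)²`;
* **`norm_osCorr_le_of_gap_slack`** — `‖osCorr τ (X, Y)‖ ≤ 2 (osVar X + osVar Y) E + δ (B_X + B_Y)² (E + 1)`.

With `δ = 0` this is `norm_osCorr_le_of_gap`. All statements here are proved.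

References: K. Osterwalder, E. Seiler, Ann. Phys. 110 (1978) 440, §2; J. Glimm, A. Jaffe, Quantum
Physics (1987), §6.1 and §19.7 (transfer matrix on a periodic box).
-/

open scoped ComplexConjugate
open Filter MeasureTheory

noncomputable section

namespace Literature.MathematicalPhysics.QuantumLattice

section PolarizationSlack

variable {Ω : Type*} [MeasurableSpace Ω]

omit [MeasurableSpace Ω] in
/-- `‖X(ω) + c Y(ω)‖ ≤ B_X + B_Y` for `‖c‖ = 1` and sup bounds `B_X, B_Y`. [folklore] -/
theorem norm_add_smul_le_of_norm_eq_one {X Y : Ω → ℂ} {BX BY : ℝ} (hBX : ∀ ω, ‖X ω‖ ≤ BX)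
    (hBY : ∀ ω, ‖Y ω‖ ≤ BY) {c : ℂ} (hc : ‖c‖ = 1) (ω : Ω) : ‖(X + c • Y) ω‖ ≤ BX + BY := by
  rw [Pi.add_apply, Pi.smul_apply, smul_eq_mul]
  refine (norm_add_le _ _).trans (add_le_add (hBX ω) ?_)
  rw [norm_mul, hc, one_mul]
  exact hBY ω

variable {μ : Measure Ω} [IsFiniteMeasure μ] {Θ τ : Ω → Ω}

/-- **Parallelogram bound with slack**: if `osVar Z ≥ −δ B²` for every good `Z` with sup bound
`B`, then for good `X, Y` with sup bounds `B_X, B_Y` and `‖c‖ = 1`,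
`osVar(X + cY) ≤ 2 osVar X + 2 osVar Y + δ (B_X + B_Y)²`
(`osVar(X + cY) + osVar(X − cY) = 2 osVar X + 2 osVar Y`). [cite: GlimmJaffe1987, §6.1] -/
theorem osVar_add_smul_le_of_slack (hΘ : Measurable Θ) {Good : (Ω → ℂ) → Prop}
    (hmeas : ∀ X, Good X → Measurable X)
    (hadd : ∀ X Y (c : ℂ), Good X → Good Y → Good (X + c • Y)) {δ : ℝ}
    (hvar : ∀ Z (B : ℝ), Good Z → (∀ ω, ‖Z ω‖ ≤ B) → -(δ * B ^ 2) ≤ osVar μ Θ Z)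
    {X Y : Ω → ℂ} (hX : Good X) (hY : Good Y) {BX BY : ℝ} (hBX : ∀ ω, ‖X ω‖ ≤ BX)
    (hBY : ∀ ω, ‖Y ω‖ ≤ BY) {c : ℂ} (hc : ‖c‖ = 1) :
    osVar μ Θ (X + c • Y) ≤ 2 * osVar μ Θ X + 2 * osVar μ Θ Y + δ * (BX + BY) ^ 2 := by
  -- adapted from `ReflectedCorrelationPolarisation` (`norm_osCorr_le_of_gap`, parallelogram step)
  have hXm := hmeas X hX
  have hYm := hmeas Y hY
  have hXb : ∃ B, ∀ ω, ‖X ω‖ ≤ B := ⟨BX, hBX⟩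
  have hYb : ∃ B, ∀ ω, ‖Y ω‖ ≤ B := ⟨BY, hBY⟩
  have hcc : conj c * c = 1 := by rw [Complex.conj_mul', hc]; simp
  have hnc : ‖-c‖ = 1 := by rw [norm_neg, hc]
  have h1 := osCorr_add_smul (μ := μ) (τ := id) hΘ measurable_id hXm hXb hYm hYb c
  have h2 := osCorr_add_smul (μ := μ) (τ := id) hΘ measurable_id hXm hXb hYm hYb (-c)
  have hnn := hvar _ (BX + BY) (hadd X Y (-c) hX hY) (norm_add_smul_le_of_norm_eq_one hBX hBY hnc)
  simp only [osVar] at hnn ⊢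
  rw [h1]
  rw [h2] at hnn
  simp only [map_neg, neg_mul, mul_neg, neg_neg, hcc, one_mul, Complex.add_re,
    Complex.neg_re] at hnn ⊢
  linarith

/-- **Polarisation with slack: a diagonal OS gap with sup-norm slack bounds off-diagonal
correlations.** On a class `Good` of measurable functions closed under `X + c • Y`: if for every
good `Z` and every sup bound `B` of `Z` one has `‖osCorr τ (Z, Z)‖ ≤ osVar Z · E + δ B²` (`E ≥ 0`)
and `osVar Z ≥ −δ B²`, then for good `X, Y` with sup bounds `B_X, B_Y`,
`‖osCorr τ (X, Y)‖ ≤ 2 (osVar X + osVar Y) E + δ (B_X + B_Y)² (E + 1)`: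
`4 osCorr(X, Y) = Σ_{c ∈ {1,−1,i,−i}} c̄ · osCorr(X + cY, X + cY)`, each `X + cY` has sup bound
`B_X + B_Y`, and `osVar(X + cY) ≤ 2 osVar X + 2 osVar Y + δ (B_X + B_Y)²`. On a torus `δ B²` is the
thermal (backward-propagation) slack of the transfer-matrix bound. [cite: GlimmJaffe1987, §6.1 and §19.7] -/
theorem norm_osCorr_le_of_gap_slack (hΘ : Measurable Θ) (hτ : Measurable τ)
    {Good : (Ω → ℂ) → Prop} (hmeas : ∀ X, Good X → Measurable X)
    (hadd : ∀ X Y (c : ℂ), Good X → Good Y → Good (X + c • Y)) {E δ : ℝ} (hE : 0 ≤ E)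
    (hgap : ∀ Z (B : ℝ), Good Z → (∀ ω, ‖Z ω‖ ≤ B) →
      ‖osCorr μ Θ τ Z Z‖ ≤ osVar μ Θ Z * E + δ * B ^ 2)
    (hvar : ∀ Z (B : ℝ), Good Z → (∀ ω, ‖Z ω‖ ≤ B) → -(δ * B ^ 2) ≤ osVar μ Θ Z)
    {X Y : Ω → ℂ} (hX : Good X) (hY : Good Y) {BX BY : ℝ} (hBX : ∀ ω, ‖X ω‖ ≤ BX)
    (hBY : ∀ ω, ‖Y ω‖ ≤ BY) :
    ‖osCorr μ Θ τ X Y‖ ≤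
      2 * (osVar μ Θ X + osVar μ Θ Y) * E + δ * (BX + BY) ^ 2 * (E + 1) := by
  -- adapted from `ReflectedCorrelationPolarisation` (`norm_osCorr_le_of_gap`)
  have hXm := hmeas X hX
  have hYm := hmeas Y hY
  have hXb : ∃ B, ∀ ω, ‖X ω‖ ≤ B := ⟨BX, hBX⟩
  have hYb : ∃ B, ∀ ω, ‖Y ω‖ ≤ B := ⟨BY, hBY⟩
  have key : ∀ c : ℂ, ‖c‖ = 1 → ‖osCorr μ Θ τ (X + c • Y) (X + c • Y)‖ ≤
      (2 * osVar μ Θ X + 2 * osVar μ Θ Y) * E + δ * (BX + BY) ^ 2 * (E + 1) := by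
    intro c hc
    have h := hgap _ (BX + BY) (hadd X Y c hX hY) (norm_add_smul_le_of_norm_eq_one hBX hBY hc)
    have hpar := mul_le_mul_of_nonneg_right
      (osVar_add_smul_le_of_slack hΘ hmeas hadd hvar hX hY hBX hBY hc) hE
    linarith
  -- polarisation identity
  have hpol : (4 : ℂ) * osCorr μ Θ τ X Y =
      osCorr μ Θ τ (X + (1 : ℂ) • Y) (X + (1 : ℂ) • Y) -
        osCorr μ Θ τ (X + (-1 : ℂ) • Y) (X + (-1 : ℂ) • Y) -
        Complex.I * osCorr μ Θ τ (X + Complex.I • Y) (X + Complex.I • Y) +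
        Complex.I * osCorr μ Θ τ (X + (-Complex.I) • Y) (X + (-Complex.I) • Y) := by
    rw [osCorr_add_smul hΘ hτ hXm hXb hYm hYb, osCorr_add_smul hΘ hτ hXm hXb hYm hYb,
      osCorr_add_smul hΘ hτ hXm hXb hYm hYb, osCorr_add_smul hΘ hτ hXm hXb hYm hYb]
    simp only [map_one, map_neg, Complex.conj_I]
    linear_combination (2 * (osCorr μ Θ τ X Y - osCorr μ Θ τ Y X)) * Complex.I_mul_I
  have h1 := key 1 (by simp)
  have h2 := key (-1) (by simp)
  have h3 := key Complex.I (by simp)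
  have h4 := key (-Complex.I) (by simp)
  have h4n : ‖(4 : ℂ) * osCorr μ Θ τ X Y‖ ≤
      4 * ((2 * osVar μ Θ X + 2 * osVar μ Θ Y) * E + δ * (BX + BY) ^ 2 * (E + 1)) := by
    rw [hpol]
    refine (norm_add_le _ _).trans ?_
    refine (add_le_add (norm_sub_le _ _) le_rfl).trans ?_
    refine (add_le_add (add_le_add (norm_sub_le _ _) le_rfl) le_rfl).trans ?_
    simp only [norm_mul, Complex.norm_I, one_mul]
    linarith
  rw [norm_mul] at h4n
  have h4' : ‖(4 : ℂ)‖ = 4 := by simp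
  rw [h4'] at h4n
  linarith

/-- Sanity check: with zero slack the hypotheses of `norm_osCorr_le_of_gap_slack` are those of
`norm_osCorr_le_of_gap` read with explicit sup bounds, and the conclusion is the same. [folklore] -/
theorem norm_osCorr_le_of_gap_slack_zero (hΘ : Measurable Θ) (hτ : Measurable τ)
    {Good : (Ω → ℂ) → Prop} (hmeas : ∀ X, Good X → Measurable X)
    (hadd : ∀ X Y (c : ℂ), Good X → Good Y → Good (X + c • Y)) {E : ℝ} (hE : 0 ≤ E)
    (hgap : ∀ Z, Good Z → ‖osCorr μ Θ τ Z Z‖ ≤ osVar μ Θ Z * E)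
    (hvar : ∀ Z, Good Z → 0 ≤ osVar μ Θ Z) {X Y : Ω → ℂ} (hX : Good X) (hY : Good Y)
    {BX BY : ℝ} (hBX : ∀ ω, ‖X ω‖ ≤ BX) (hBY : ∀ ω, ‖Y ω‖ ≤ BY) :
    ‖osCorr μ Θ τ X Y‖ ≤ 2 * (osVar μ Θ X + osVar μ Θ Y) * E := by
  have h := norm_osCorr_le_of_gap_slack (δ := 0) hΘ hτ hmeas hadd hE
    (fun Z B hZ _ => by simpa using hgap Z hZ) (fun Z B hZ _ => by simpa using hvar Z hZ)
    hX hY hBX hBY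
  simpa using h

end PolarizationSlack

end Literature.MathematicalPhysics.QuantumLattice

end
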